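import Mathlib
import HarnessLib
import HarnessLib.Audit
import Summits.ResolutionOfSingularities.Statement
import Literature.AlgebraicGeometry.Resolution.Blowups
import HarnessLib.Audit.Status.Attr

/-!
Route: VerticalModels

DORMANT since 2026-08-24T09:02:48Z (reconciler: no traction for 6.6 d (last activity item-evidence-added at 2026-08-17T16:54:37Z); parked, not closed — `ledger route dormant route-ResolutionOfSingularities-VerticalModels --off` to react) — unstaffed, not closed; items shared with open routes are served there. `ledger route dormant <id> --off` reactivates.

# Route VerticalModels — resolve the generic fibre over k(t) by induction, then the vertical model:
tame arcs by Néron dilatations, wild core = p-divisible arc orders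

BARRIER-INVERSION route (operator C). Assume the catalogue: no pointwise Taylor-type invariant
survives (KangarooShadeIncrease,
ResidualOrderUnbounded, NarasimhanMaximalContact, DirectrixSmallCharacteristic), regularity is not
transportable along inseparable base
change (InseparableBaseChange ×3, FrobeniusTwistResolution), local uniformization has no fourth
patching step and no map-monomialization
(DimensionFourFrontier, LocalMonomializationFails, ArtinSchreierPuiseux). Then a successful line
must (a) globalize WITHOUT patching,
(b) work over ALL fields natively, (c) measure progress by lengths/orders along ARCS rather than by
orders of coefficient ideals, with
centres that are whole strata. It suffices to show X = VerticalResolution: for every prime p, every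
field k of char p, every integral
separated finite-type X with a morphism f : X → A¹_k and an irreducible q ∈ k[T] such that X is
regular off the fibre V(q∘f) (and that
fibre is not all of X), there is a blow-up X' → X along an ideal sheaf cosupported in the fibre with
X' regular — the equal-characteristic
MODELS problem (CossartPiltant2019 Cor. 1.3 one dimension up: a regular (n−1)-fold over k(t) given
with a model, regular off one closed
fibre). X is reached as TameArcRegularization ∧ WildCoreResolution (the fibre split by ARC ORDERS of
the base parameter: a point is tame
if some arc Spec k'⟦s⟧ → X through it has ord_s(q) prime to p), and X decides the summit through
PencilReduction (VerticalResolution → summit), whose proof is an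
induction on dimension that CONSUMES the summit's 'for all fields': the generic fibre of any pencil
X̃ → P¹_k is an (n−1)-fold over the
imperfect field k(t). No card is realised (none files this line); cards neron-delta-arc-smoothening
/ slice-the-base-not-the-fibre are
thematically adjacent and should be linked if their authors agree.
Lean: `TameArcRegularization ∧ WildCoreResolution ∧ VerticalSplit ∧ PencilReduction`

## Assembly
Pure logic: `closes (hT : TameArcRegularization) (hW : WildCoreResolution) (hS : VerticalSplit) (hR
: PencilReduction) :
_root_.ResolutionOfSingularities := hR (hS hT hW)` (Sketch.lean = glue.lean, lean check rc 0, no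
sorry, standard axioms; the target
VerticalResolution is DERIVED inside the deciding theorem as `hS hT hW`, and PencilReduction's
conclusion is literally the Statement
decl). All mathematics of the reduction (the induction on dimension over all fields, spreading,
gluing, reduced ⇒ integral) sits
INSIDE the crux PencilReduction, and the composition of the engine into the models statement inside
VerticalSplit; both are
provable now. The route file imports only the Statement and the tree's Blowups.lean (IsBlowup,
universal property; its named fact
Stacks02NS is discharged — Literature.AlgebraicGeometry.Resolution.stacks02NS_holds — and used by no
item); the earlier DominatingDVR
import (fact-free, redundant under Mathlib) was dropped at rev 2. No Literature named fact is a
hypothesis of anything; the only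
unproved named facts in the import cone are the Statement-borne Hironaka1964 / CossartPiltant2019,
which no item uses. The Assembly
item below is the ENGINE assembly `TameArcRegularization → WildCoreResolution → summit` (rev 1: the
pure-logic form, literally the
type of `closes`, was ground-trivial); it follows in one line from VerticalSplit + PencilReduction
and is not a hypothesis of `closes`.

Rationale: WHY THIS LINE. PencilReduction (provable now, EGAIV3 §8 spreading + Hartshorne1977 II.7.17 +
StacksProject 080B): pick any non-constant t ∈ k(X),
X̃ = graph closure → P¹_k; by induction on dimension the generic fibre X̃_η (dimension n−1, over the
FIELD k(t)) has a blow-up resolution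
Bl_{J_η}; spread J_η to an ideal J on X̃ (extend by the maximal extension), so X₁ = Bl_J X̃ is
regular over a dense open V ⊂ P¹ and the
problem is confined to finitely many VERTICAL fibres; fibre-cosupported blow-ups over disjoint
fibres glue as the blow-up of a product
ideal, and reduced ⇒ integral is in tree (Theorems.descentReducedToIntegral_proof) — so no Zariski
patching, no Nagata, no descent of
the ground field: imperfect fields are an INPUT the induction needs, not an obstacle
(InseparableBaseChange inverted). The residual
VerticalResolution is the problem class of regular models over discrete valuation rings
(CossartPiltant2019 Cor. 1.3; in characteristic
0 the relative desingularization of AbramovichTemkinWodarczyk2020 = arXiv:2003.03659, there with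
base change and log smoothness, here
only regularity of the total space), where a toolset no route on the ledger uses applies verbatim in
characteristic p: Néron's
smoothening by dilatations (Neron1964; BoschLutkebohmertRaynaud1990 Ch. 3; MayeuxRicharzRomagny2020
= arXiv:2001.03597 §2 for
dilatations of general schemes) terminates by Néron's defect δ — a LENGTH of torsion of pulled-back
differentials along sections, not an
order of a coefficient ideal — and the vertical hypothesis is exactly what bounds it (Sing X ⊂ V(q)
⇔ the Jacobian ideal contains a power
of q ⇔ ord_a(Jac)/ord_a(q) ≤ N along every arc: 'isolated in the t-direction'). The engine splits
the fibre by arc orders: points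
reached by an arc with ord(q) = e prime to p are handled by the tame cyclic base change s^e = q,
Néron smoothening upstairs
(unramified arcs land in the smooth locus; smooth ⇒ regular), the μ_e-quotient (linearly reductive,
equivariance of the canonical
smoothening) and tame destackification (BerghRydh2019) — TameArcRegularization; what no tame arc
reaches (all arcs have p | ord q, e.g.
points adjacent only to fibre components of multiplicity divisible by p: for odd p, q² + q x^p + z^p
+ q³y = 0 is a normal threefold specimen,
smooth generic fibre A², fibre p·(plane), singular along a line, resolved by the normalized
Frobenius base change s^p = q which is
REGULAR upstairs) is WildCoreResolution, the honest wild core, now organised as 'p-divisible arc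
orders of the base parameter' and
attackable by Frobenius-untwisting the base (the normalization of X ×_{k[q]} k[q^{1/p}] is again a
vertical model, of smaller p-part)
plus descent along the rational vector field ∂_s (1-foliation quotients) or pAlteration's
radicial-bottom sandwich. Imported areas:
arithmetic geometry of models over DVRs (Néron models, dilatations, stable reduction), arc/jet
schemes (Greenberg, Denef–Loeser change
of variables for constructibility of 'reached by an arc of order e'), tame stacks. No open route
fibres X over a curve, uses Néron's δ,
dilatations, or arc orders; SectionAscent also consumes 'all fields' but through generic hyperplane
SECTIONS with regularity ASCENT
(A/(ℓ) regular ⇒ A regular) toward a one-shot strong statement, its residue being closed points of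
fibres of ONE blow-up — here generic
FIBRES, the weak statement, no ascent, residue = whole vertical fibres = models;
Valuative/CyclicCovers need PatchingRel (open in dim ≥ 4),
which this line replaces by base-local gluing;
Descent/WeightedInvariant/CleanCovers/MarkedTransfer/UniversalCells/EquisingularLift pay
DescentPerfectToAll, which this line never meets.

RANKED CRUXES. #0 VerticalResolution (target) — VERTICAL RESOLUTION (equal-characteristic models
problem): p prime, k any field of char p, X integral, f : X → A¹_k = Spec k[T] separated of finite
type, q ∈ k[T] irreducible, t := f^*q; if some point has t a unit (the fibre V(t) is not everything)
and X is regular at every point where t is a unit, then there are an ideal sheaf I on X with support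
inside V(t), and a blow-up π : X' → X of I with X' regular (π is projective, an isomorphism off
V(t), hence a resolution). (why it might fail: it contains every isolated singularity (t arbitrary)
and every Moh/Hauser–Perlega/CP-Rem-3.2 germ (all vertical for a coordinate t), open from dim 4; the
BLOW-UP form (global projectivity) is printed in dim 3 only locally over affine covers
(CossartPiltant2019 Thm 1.1).) [CossartPiltant2019, BoschLutkebohmertRaynaud1990, Lipman1978,
arXiv:2003.03659]
#2 WildCoreResolution (crux) — WILD CORE: for vertical data (p, k, X, f, q) as in the target, IF X
is already regular at every TAME-REACHABLE point — every x admitting a field k' and an arc a : Spec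
k'⟦s⟧ → X centred at x with ord_s(a^* f^* q) = m finite and p ∤ m — THEN the target's conclusion
holds for X (blow-up along an ideal cosupported in the fibre, regular total space). The singular
points left are those all of whose arcs meet the fibre with order divisible by p (or lie in it):
α_p/∂_s-quotients of regular models over k[q^{1/p}], p-multiple fibre components. [difficulty:
open-problem] (why it might fail: it is the wild core t^p-type residue of every programme (Picover's
radicial bottoms: X = Y/∂_s with Y regular over k[q^{1/p}]) in vertical clothing;
Frobenius-untwisting the base may not lower the p-part for mixed fibres, and 1-foliation resolution
is open in dim ≥ 4.) [CossartPiltant2019, arXiv:1802.05010, arXiv:0804.1554,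
BoschLutkebohmertRaynaud1990, Neron1964]
#3 TameArcRegularization (crux) — TAME ARCS: for vertical data (p, k, X, f, q) as in the target
there is a blow-up π : X' → X along an ideal sheaf cosupported in the fibre such that X' is regular
at every point x' reached by a tame arc of (X', π ≫ f, q) (some a : Spec k'⟦s⟧ → X' centred at x'
with ord_s of the pulled-back q equal to m, p ∤ m). Intended proof: bounded tame orders
(constructibility of arc conditions), tame totally ramified base change s^e = q, Néron smoothening
of the normalized base change by blow-ups of Néron's canonical centres (all unramified arcs land in
the smooth, hence regular, locus; termination by Néron's defect δ, bounded because Jac ⊇ (q^N)),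
μ_e-equivariance of the canonical smoothening, μ_e-quotient (linearly reductive: (X ⊗ O_e)^{μ_e} =
X), tame abelian quotient singularities of the regular locus resolved functorially (Bergh–Rydh
destackification / toric), extension of that blow-up over the wild locus by closing its ideal.
[difficulty: L] (why it might fail: BLR 3.1/3 controls sections with SEPARABLE residue field over
k(c); tame arcs with inseparable residue field (imperfect k(c)) and a uniform bound on minimal tame
orders near wild points are not in print — either may force moving such points to the wild side.)
[BoschLutkebohmertRaynaud1990, Neron1964, arXiv:2001.03597, BerghRydh2019, GrothendieckMurre1971,
arXiv:1905.00872]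
#4 PencilReduction (crux) — PENCIL REDUCTION: VerticalResolution → ResolutionOfSingularities — the
equal-characteristic models problem decides the summit. Proof on paper (all fields, all primes at
once): by strong induction on n prove that every INTEGRAL separated finite-type X of dimension ≤ n
over ANY field K of char p has a resolution which is a blow-up — reduce to X ⊆ Pᴺ projective (Chow +
projective closure as in the tree's ProjectiveIntegralSuffices; blow-ups pull back), take any
non-constant t = ℓ₁/ℓ₀ ∈ K(X), X̃ = Bl_{(ℓ₀,ℓ₁)} X → P¹_K, generic fibre X̃_η integral of dimension
n−1 over the field K(t) (universe 0: RatFunc K), induction gives Bl_{J_η} X̃_η regular, spread J_η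
to J_V (EGAIV3 8.5) and extend to J̄ on X̃ with V(J̄) = closure V(J_V), X₁ = Bl_{J̄} X̃ is regular
on the generic fibre hence (Reg open on excellent schemes, X₁ → P¹ proper) over a dense open V, bad
points c₁..c_r closed; each c_i lies in an affine line chart, apply VerticalResolution to X₁|_{V_i}
→ V_i ⊂ A¹ (V_i ∋ c_i avoiding the other c_j) to get Bl_{I_i} cosupported in the fibre over c_i,
extend I_i by O off that closed fibre, blow up ∏ I_i (disjoint cosupports: the blow-ups glue),
compose the three blow-ups (StacksProject 080B); blow-up ⇒ proper birational from a regular scheme =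
HasResolution; reduced ⇒ integral per field is Theorems.descentReducedToIntegral_proof (in tree);
conclude ∀ p prime, ResolutionInChar p. [deps: VerticalSplit] [difficulty: L] (why it might fail:
Lean weight only: spreading an ideal sheaf and regularity from the generic fibre over RatFunc K (EGA
IV 8.5.2/8.10.5, Reg open), blow-up under flat base change, dim n−1 of the generic fibre,
composing/gluing blow-ups — no mathematical risk identified.) [EGAIV3, Hartshorne1977,
StacksProject, CossartPiltant2019, Liu2002]
#5 VerticalSplit (crux) — VERTICAL SPLIT: TameArcRegularization → WildCoreResolution →
VerticalResolution. Proof on paper: given vertical data (X, f, q), TameArcRegularization yields a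
blow-up π : X' → X along I cosupported in the fibre with X' regular at all tame-reachable points of
(X', π ≫ f, q); X' is again integral (blow-up of an integral scheme along an ideal whose support is
not everything), π ≫ f is separated of finite type (blow-ups of Noetherian schemes are proper), the
fibre complement is still inhabited (π is an isomorphism off the support) and X' is regular off the
fibre; WildCoreResolution applied to (X', π ≫ f, q) yields a second fibre-cosupported blow-up with
regular total space; two blow-ups of a Noetherian integral scheme along fibre-cosupported ideals
compose to ONE blow-up along a fibre-cosupported ideal (StacksProject 080B; tree BlowupsComposition
/ IsBlowup.exists_isBlowup_comp_supported). [deps: TameArcRegularization, WildCoreResolution]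
[difficulty: M] (why it might fail: typing only — the composition lemma for IsBlowup with control of
the composite ideal's support, integrality of blow-ups and transport of the finite-type hypotheses
to X' must match the tree's API exactly.) [StacksProject, Hartshorne1977, Liu2002]

TWO-LAYER PLAN. Foreseen glued splits, filed only when a crux moves (D-0019, k ≤ 3, depth 1):
TameArcRegularization ⇐ NeronBlowupSmoothening (BLR 3.1/3 in blow-up form: after finitely many
blow-ups of Néron's canonical centres every
arc with ord(q) = 1 and separable residue field is centred in the regular locus — a theorem to
formalize) → TameCyclicDescent (base change
s^e = q, equivariant smoothening, μ_e-quotient + Bergh–Rydh on the regular locus, extension) →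
TameArcRegularization.
WildCoreResolution ⇐ FrobeniusUntwist (the normalized base change along k[q] → k[q^{1/p}] of a
wild-core vertical model is a vertical
model whose wild core has smaller p-part / is eventually tame) → RadicialDescentVertical (X = Y/∂_s
for Y resolved: resolve the
1-foliation generated by s·∂_s-type fields on regular Y by vertical blow-ups until multiplicative,
quotient toroidal; or feed pAlteration's
PicoverToRadicialBottom/Picover through the Frobenius sandwich K(Y)^p ⊂ K(X) ⊂ K(Y)) →
WildCoreResolution.
PencilReduction ⇐ SpreadAndExtend (generic-fibre blow-up resolution ⇒ blow-up regular over a dense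
open of P¹) → BaseLocalGluing → PencilReduction
(only if a prover wants the Lean work split; mathematically one piece). VerticalSplit is already the
glue of the engine split and is not split further.

KILL CRITERIA. ¬VerticalResolution for some explicit vertical fourfold model over F_p is ¬(summit in
blow-up form): a PROBLEM-LEVEL event — file the
witness as refutation evidence against the summit's projective form, do not merely close the route.
TameArcRegularization refuted ⇒
mis-cut of the tame/wild boundary (the witness will be a tame arc with inseparable residue field or
an unbounded family of minimal tame
orders): REPAIR by restating tame-reachability (separable residue clause / bounded order) and moving
the witness class into
WildCoreResolution's hypothesis — not a closure. WildCoreResolution shown EQUIVALENT to Picover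
(pAlteration stmt-0554) by a refuter ⇒
close `superseded --by route-ResolutionOfSingularities-pAlteration` unless FrobeniusUntwist has by
then produced a strictly smaller core.
PencilReduction or VerticalSplit refuted can only be a typing slip (RatFunc universe, dimension of
the generic fibre, blow-up base change,
support of a composite blow-up ideal): repair, never close. A functorial resolution over all fields
(WeightedInvariant + descent) moots the route; CP-style LU₄ + Patching₄ (Valuative) does not
(different output: this line yields blow-ups).

NOT DECOMPOSED YET. Néron's defect δ and dilatations as Lean definitions (definition requests below)
and the blow-up form of BLR 3.1/3; the bound on minimal
tame arc orders (Greenberg/Denef–Loeser constructibility of {x : some arc through x has ord q = e});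
the μ_e-equivariance and quotient
bookkeeping; the precise 'p-part' that FrobeniusUntwist should lower (multiplicities of fibre
components adjacent to a point vs. the
semigroup of arc orders S(x) = {ord_a(q)}); the relation of the wild core to Picover (is every
wild-core germ a radicial bottom of a
REGULAR vertical model? true for the specimen q² + q x^p + z^p + q³y, p odd); imperfect-residue
points (Hironaka's quadric is a vertical
instance over k(λ, μ)). All layer-2, after a crux moves (D-0019).

CHEAPEST FALSIFIER. (1) Hand computations done: the catalogued monsters are vertical and fall where
predicted — CP Rem 3.2 (h = Z^p + u₄u₁^p + u₃u₂^p,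
t = u₁: regular off u₁ = 0 as ∂_{u₄}h = u₁^p; generic fibre ≅ A³ smooth; over perfect k every closed
point of the fibre carries sections:
entirely TAME, Néron's process must act); Hauser's kangaroo (p = 2, t = y⁷ + yz⁴: F|_Crit ≡ 0, fibre
2·{x = F = 0}); q² + qx^p + z^p + q³y, p odd
(all arc orders of q divisible by p: WILD core; normalized Frobenius base change = A³ regular).
First refuter job: run Néron's algorithm
(blow up the closure of the maximal-δ section locus, repeat) on CP Rem 3.2 over F_p[u₁]_{(u₁)}: does
it end REGULAR? (prediction: yes).
(2) Cheapest kill of the line: a vertical threefold model (dim 3, where VerticalResolution is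
CossartPiltant2019) with minimal tame arc
orders UNBOUNDED along a curve of wild points — TameArcRegularization then needs the bounded-order
restatement at once.
(3) Lookup run 2026-08-16 (queries under Novelty): no paper iterates Néron smoothening to REGULARITY
of a model; 'Néron desingularization'
hits are Popescu's ring-map theorem; relative desingularization exists in char 0 only
(arXiv:2003.03659).

NUMBERS. dim ≤ 3: VerticalResolution holds in the proper (locally projective) form by
CossartPiltant2019 Thm 1.1 (i)(ii) (π iso over Reg ⊇ X ∖ V(t),
projective over each member of a specified affine cover) and Cor. 1.3 (regular models of regular
projective surfaces over excellent
Dedekind domains); dim 2: Lipman1978 (normalized blow-ups: projective). First open case: n = 4, i.e.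
regular threefolds over k(t) with a
given model. Néron's defect along a section a: δ(a) = length of the torsion of a^*Ω¹_{X/O}; BLR:
bounded on X(O^{sh}) when X_K is smooth,
drops by ≥ 1 under the dilatation of the canonical centre; here ord_a(Jac_X) ≤ N·ord_a(q) for ALL
arcs with q^N ∈ Jac. Wild-core specimen:
q² + q x^p + z^p + q³y over F_p, p odd, n = 3, Sing = the y-axis, fibre multiplicity p, tame orders:
none (for p = 2 the same equation has
the tame arc (q, x, z, y) = (s, 0, s + s², s)).

DEFINITION REQUESTS. Definitions (topic Literature/AlgebraicGeometry/NeronModels, new): `Dilatation`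
(MayeuxRicharzRomagny2020 = arXiv:2001.03597 Def. 2.1/2.x:
affine blow-up of X in Z along a locally principal D, as Spec of the degree-0 part of the Rees
algebra localized at a generator of I_D —
the tree's affineBlowup is the case D = V(generator)); `NeronDefect` (BLR §3.3: δ(a) := length_{O'}
of the torsion submodule of a^*Ω¹_{X/O}
for an O'-valued point a, O' a DVR); `ArcOrderAlong` (ord_s of the pull-back of a global section
along Spec k'⟦s⟧ → X — used inline in the
items via PowerSeries.order, worth a named API). Cite facts wanted: BLR 1990 §3.1 Thm. 3 (existence
of smoothenings by dilatations in
special fibres for X of finite type over a DVR with smooth generic fibre) as a named fact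
`Neron1964Smoothening`; EGA IV₃ 8.10.5 + 9.x
spreading of properness/regularity-type properties from the generic fibre (partly in tree under
Literature/AlgebraicGeometry/Limits).

Novelty: Searches (2026-08-16): `lit frontier ResolutionOfSingularities --since 2021` (30 rows; none on
models/Néron; arXiv:2602.06553 'evolving
ranking functions for canonical blow-ups in char p' noted); `lit search --source arxiv` title
searches 'Néron blowups' (2: arXiv:2001.03597,
Melo–Viviani), 'multi-centered dilatations' (arXiv:2303.07712, arXiv:2411.15606), 'Néron
desingularization' (8: arXiv:1702.01445,
arXiv:1702.01867, arXiv:1910.09123 Popescu — General Néron Desingularization of ring maps, not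
models), 'regular models' (Liu
arXiv:2603.19065 hyperelliptic curves), 'smoothening'/'dilatations' (noise); `lit search --source
zbmath` 'Neron smoothening
desingularization' (0), 'regular model equal characteristic higher dimension' (4, none relevant),
'relative resolution of singularities
over a curve' (de Jong 1996 alterations, Lipman 1979); `lit galaxy search --star all` 'relative
desingularization' (1: arXiv:2003.03659),
'Néron smoothening'/'smoothening process'/'Néron desingularization' (noise + Kollár 2007); galaxy
title/author searches for BLR 'Néron
Models' (not in any internal corpus; lit want acq-06266 filed); `lit read` arXiv:2001.03597 pp. 1–6
(Def. 2.1 dilatations, absolute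
setting), arXiv:1412.0868 pp. 1–5 (Thm 1.1 with its locally-projective clause, Cor. 1.3 models, the
'not even known … blowing up an
ideal sheaf whose zero locus is Sing' remark); local searchd down (rc: connection reset) all
session, OpenAlex/S2 rate-limited — stated
limitation; all 15 route files, t  [refs: 10.1007/bf02698644, 2602.06553, 2001.03597, 2303.07712, 2411.15606, 1702.01445, 1702.01867, 1910.09123, 2603.19065, 2003.03659, 1412.0868, doi:10.1007/bf02698644, CossartPiltant2019, AbramovichTemkinWodarczyk2020, Neron1964, BoschLutkebohmertRaynaud1990]

Barriers (technique_class: generic-fibre-induction neron-dilatations arc-orders): - technique_class: generic-fibre-induction neron-dilatations arc-orders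
- Literature.Barriers.ResolutionOfSingularities.DimensionFourFrontier: EVADED as architecture — no
local uniformization, no Zariski patching, no ELU one dimension down: the induction input is the
WEAK summit in dimension n−1 over the field k(t), globalization is gluing of blow-ups cosupported in
disjoint fibres; NOT evaded as difficulty — VerticalResolution(4) contains the frontier's fourfold
germs (CP Rem 3.2 is a vertical, even tame, instance), the bet being that Néron's canonical
procedure acts on them where invariants stall.
- Literature.Barriers.ResolutionOfSingularities.InseparableBaseChange (and
InseparableBaseChangeResolution, RegularNotGeometricallyRegular, FrobeniusTwistResolution): INVERTED
— the line never base-changes the ground field and never asks for smoothness over k; it needs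
imperfect fields k(t) as inputs of the induction and certifies regularity of stalks only
(smooth-along-sections ⇒ regular is the one-way implication used); the tame base change s^e = q is
separable, and the only inseparable base change (Frobenius-untwist inside WildCoreResolution) is
followed by NORMALIZATION and used through the sandwich K(Y)^p ⊂ K(X) ⊂ K(Y), exactly the
configuration the barrier permits (radicial bottom/top of a regular scheme), not 'resolve then
base-change'.
- Literature.Barriers.ResolutionOfSingularities.Hauser2003_kangarooShadeIncrease /
ResidualOrderUnbounded (hauserPerlega_mohProofBoundFails

History (route lifecycle, newest last):
- 2026-08-16T18:14:03Z · rev 1: restated Assembly (stmt-ResolutionOfSingularities-16201) — @note1.txt (planner-rrepair-ResolutionOfSingularities-Vert-441a035c-0)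
- 2026-08-24T09:02:48Z · DORMANT — reconciler: no traction for 6.6 d (last activity item-evidence-added at 2026-08-17T16:54:37Z); parked, not closed — `ledger route dormant route-ResolutionOfSing (operator:999:2322076)

sub-problem: ResolutionOfSingularities · status: dormant · opened planner-plan-novel-ResolutionOfSingularities-Re-dc19aa3a-c-v2-g3-0 2026-08-16T18:04:29Z · rev 2 · ledger route-ResolutionOfSingularities-VerticalModels
GENERATED by the gate from the ledger (D-0016/17). Provers cite these decls: `theorem foo : Summit.ResolutionOfSingularities.ResolutionOfSingularities.Theses.VerticalModels.<Decl> := …` in Summits/ResolutionOfSingularities/ResolutionOfSingularities/Theorems/<Name>.lean.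
-/

namespace Summit.ResolutionOfSingularities.ResolutionOfSingularities.Theses.VerticalModels

open scoped BigOperators Topology Manifold Classical MeasureTheory ProbabilityTheory Matrix InnerProductSpace ComplexConjugate ContinuousMap
open Filter Set Function TopologicalSpace MeasureTheory

attribute [summit_statement] _root_.ResolutionOfSingularities

/-- item stmt-ResolutionOfSingularities-16196 · target · rank 0 · open · by planner
why it might fail: it contains every isolated singularity (t arbitrary) and every Moh/Hauser–Perlega/CP-Rem-3.2 germ (all vertical for a coordinate t), open from dim 4; the BLOW-UP form (global projectivity) is printed in dim 3 only locally over affine covers (CossartPiltant2019 Thm 1.1).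
sources: CossartPiltant2019, BoschLutkebohmertRaynaud1990, Lipman1978, arXiv:2003.03659
[target] VERTICAL RESOLUTION (equal-characteristic models problem): p prime, k any field of char p,
X integral, f : X → A¹_k = Spec k[T] separated of finite type, q ∈ k[T] irreducible, t := f^*q; if
some point has t a unit (the fibre V(t) is not everything) and X is regular at every point where t
is a unit, then there are an ideal sheaf I on X with support inside V(t), and a blow-up π : X' → X
of I with X' regular (π is projective, an isomorphism off V(t), hence a resolution). -/
@[route_item "route-ResolutionOfSingularities-VerticalModels"]
def VerticalResolution : Prop :=
  ∀ p : ℕ, p.Prime → ∀ (k : Type) [Field k] [CharP k p] (X : AlgebraicGeometry.Scheme.{0}) (f : X ⟶ AlgebraicGeometry.Spec (.of (Polynomial k))) (q : Polynomial k), Irreducible q → AlgebraicGeometry.IsIntegral X → AlgebraicGeometry.IsSeparated f → AlgebraicGeometry.LocallyOfFiniteType f → AlgebraicGeometry.QuasiCompact f → (∃ x : X, IsUnit (X.presheaf.germ ⊤ x trivial (f.appTop ((AlgebraicGeometry.Scheme.ΓSpecIso (.of (Polynomial k))).inv q)))) → (∀ x : X, IsUnit (X.presheaf.germ ⊤ x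 trivial (f.appTop ((AlgebraicGeometry.Scheme.ΓSpecIso (.of (Polynomial k))).inv q))) → IsRegularLocalRing (X.presheaf.stalk x)) → ∃ (I : X.IdealSheafData) (X' : AlgebraicGeometry.Scheme.{0}) (π : X' ⟶ X), Literature.AlgebraicGeometry.Resolution.IsBlowup π I ∧ (I.support : Set X) ⊆ {x | ¬ IsUnit (X.presheaf.germ ⊤ x trivial (f.appTop ((AlgebraicGeometry.Scheme.ΓSpecIso (.of (Polynomial k))).inv q)))} ∧ Literature.AlgebraicGeometry.Resolution.Scheme.IsRegular X'

/-- item stmt-ResolutionOfSingularities-16197 · crux · rank 2 · open · by planner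
why it might fail: it is the wild core t^p-type residue of every programme (Picover's radicial bottoms: X = Y/∂_s with Y regular over k[q^{1/p}]) in vertical clothing; Frobenius-untwisting the base may not lower the p-part for mixed fibres, and 1-foliation resolution is open in dim ≥ 4.
sources: CossartPiltant2019, arXiv:1802.05010, arXiv:0804.1554, BoschLutkebohmertRaynaud1990, Neron1964
[crux] WILD CORE: for vertical data (p, k, X, f, q) as in the target, IF X is already regular at
every TAME-REACHABLE point — every x admitting a field k' and an arc a : Spec k'⟦s⟧ → X centred at x
with ord_s(a^* f^* q) = m finite and p ∤ m — THEN the target's conclusion holds for X (blow-up along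
an ideal cosupported in the fibre, regular total space). The singular points left are those all of
whose arcs meet the fibre with order divisible by p (or lie in it): α_p/∂_s-quotients of regular
models over k[q^{1/p}], p-multiple fibre components. [difficulty: open-problem] -/
@[route_item "route-ResolutionOfSingularities-VerticalModels", crux]
def WildCoreResolution : Prop :=
  ∀ p : ℕ, p.Prime → ∀ (k : Type) [Field k] [CharP k p] (X : AlgebraicGeometry.Scheme.{0}) (f : X ⟶ AlgebraicGeometry.Spec (.of (Polynomial k))) (q : Polynomial k), Irreducible q → AlgebraicGeometry.IsIntegral X → AlgebraicGeometry.IsSeparated f → AlgebraicGeometry.LocallyOfFiniteType f → AlgebraicGeometry.QuasiCompact f → (∃ x : X, IsUnit (X.presheaf.germ ⊤ x trivial (f.appTop ((AlgebraicGeometry.Scheme.ΓSpecIso (.of (Polynomial k))).inv q)))) → (∀ x : X, IsUnit (X.presheaf.germ ⊤ x trivial (f.appTop ((AlgebraicGeometry.Scheme.ΓSpecIso (.of (Polynomial k))).inv q))) → IsRegularLocalRing (X.presheaf.stalk x)) → (∀ x : X, (∃ (k' : Type) (_ : Field k') (a : AlgebraicGeometry.Spec (.of (PowerSeries k')) ⟶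 X) (m : ℕ), a.base (IsLocalRing.closedPoint (PowerSeries k')) = x ∧ ((AlgebraicGeometry.Scheme.ΓSpecIso (.of (PowerSeries k'))).hom ((CategoryTheory.CategoryStruct.comp a f).appTop ((AlgebraicGeometry.Scheme.ΓSpecIso (.of (Polynomial k))).inv q))).order = m ∧ ¬ p ∣ m) → IsRegularLocalRing (X.presheaf.stalk x)) → ∃ (I : X.IdealSheafData) (X' : AlgebraicGeometry.Scheme.{0}) (π : X' ⟶ X), Literature.AlgebraicGeometry.Resolution.IsBlowup π I ∧ (I.support : Set X) ⊆ {x | ¬ IsUnit (X.presheaf.germ ⊤ x trivial (f.appTop ((AlgebraicGeometry.Scheme.ΓSpecIso (.of (Polynomial k))).inv q)))} ∧ Literature.AlgebraicGeometry.Resolution.Scheme.IsRegular X'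

/-- item stmt-ResolutionOfSingularities-16198 · crux · rank 3 · open · by planner
why it might fail: BLR 3.1/3 controls sections with SEPARABLE residue field over k(c); tame arcs with inseparable residue field (imperfect k(c)) and a uniform bound on minimal tame orders near wild points are not in print — either may force moving such points to the wild side.
sources: BoschLutkebohmertRaynaud1990, Neron1964, arXiv:2001.03597, BerghRydh2019, GrothendieckMurre1971, arXiv:1905.00872
[crux] TAME ARCS: for vertical data (p, k, X, f, q) as in the target there is a blow-up π : X' → X
along an ideal sheaf cosupported in the fibre such that X' is regular at every point x' reached by a
tame arc of (X', π ≫ f, q) (some a : Spec k'⟦s⟧ → X' centred at x' with ord_s of the pulled-back q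
equal to m, p ∤ m). Intended proof: bounded tame orders (constructibility of arc conditions), tame
totally ramified base change s^e = q, Néron smoothening of the normalized base change by blow-ups of
Néron's canonical centres (all unramified arcs land in the smooth, hence regular, locus; termination
by Néron's defect δ, bounded because Jac ⊇ (q^N)), μ_e-equivariance of the canonical smoothening,
μ_e-quotient (linearly reductive: (X ⊗ O_e)^{μ_e} = X), tame abelian quotient singularities of the
regular locus resolved functorially (Bergh–Rydh destackification / toric), extension of that blow-up
over the wild locus by closing its ideal. [difficulty: L] -/
@[route_item "route-ResolutionOfSingularities-VerticalModels", crux]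
def TameArcRegularization : Prop :=
  ∀ p : ℕ, p.Prime → ∀ (k : Type) [Field k] [CharP k p] (X : AlgebraicGeometry.Scheme.{0}) (f : X ⟶ AlgebraicGeometry.Spec (.of (Polynomial k))) (q : Polynomial k), Irreducible q → AlgebraicGeometry.IsIntegral X → AlgebraicGeometry.IsSeparated f → AlgebraicGeometry.LocallyOfFiniteType f → AlgebraicGeometry.QuasiCompact f → (∃ x : X, IsUnit (X.presheaf.germ ⊤ x trivial (f.appTop ((AlgebraicGeometry.Scheme.ΓSpecIso (.of (Polynomial k))).inv q)))) → (∀ x : X, IsUnit (X.presheaf.germ ⊤ x trivial (f.appTop ((AlgebraicGeometry.Scheme.ΓSpecIso (.of (Polynomial k))).inv q))) → IsRegularLocalRing (X.presheaf.stalk x)) → ∃ (I : X.IdealSheafData) (X' : AlgebraicGeometry.Scheme.{0}) (π : X' ⟶ X), Literature.AlgebraicGeometry.Resolution.IsBlowup π I ∧ (I.support : Set X) ⊆ {x | ¬ IsUnit (X.presheaf.germ ⊤ x trivial (f.appTop ((AlgebraicGeometry.Scheme.ΓSpecIso (.of (Polynomial k))).inv q)))} ∧ ∀ x' : X', (∃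 (k' : Type) (_ : Field k') (a : AlgebraicGeometry.Spec (.of (PowerSeries k')) ⟶ X') (m : ℕ), a.base (IsLocalRing.closedPoint (PowerSeries k')) = x' ∧ ((AlgebraicGeometry.Scheme.ΓSpecIso (.of (PowerSeries k'))).hom ((CategoryTheory.CategoryStruct.comp a (CategoryTheory.CategoryStruct.comp π f)).appTop ((AlgebraicGeometry.Scheme.ΓSpecIso (.of (Polynomial k))).inv q))).order = m ∧ ¬ p ∣ m) → IsRegularLocalRing (X'.presheaf.stalk x')

/-- item stmt-ResolutionOfSingularities-16199 · crux · rank 4 · open · by planner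
why it might fail: Lean weight only: spreading an ideal sheaf and regularity from the generic fibre over RatFunc K (EGA IV 8.5.2/8.10.5, Reg open), blow-up under flat base change, dim n−1 of the generic fibre, composing/gluing blow-ups — no mathematical risk identified.
sources: EGAIV3, Hartshorne1977, StacksProject, CossartPiltant2019, Liu2002
[crux] PENCIL REDUCTION: VerticalResolution → ResolutionOfSingularities — the equal-characteristic
models problem decides the summit. Proof on paper (all fields, all primes at once): by strong
induction on n prove that every INTEGRAL separated finite-type X of dimension ≤ n over ANY field K
of char p has a resolution which is a blow-up — reduce to X ⊆ Pᴺ projective (Chow + projective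
closure as in the tree's ProjectiveIntegralSuffices; blow-ups pull back), take any non-constant t =
ℓ₁/ℓ₀ ∈ K(X), X̃ = Bl_{(ℓ₀,ℓ₁)} X → P¹_K, generic fibre X̃_η integral of dimension n−1 over the
field K(t) (universe 0: RatFunc K), induction gives Bl_{J_η} X̃_η regular, spread J_η to J_V (EGAIV3
8.5) and extend to J̄ on X̃ with V(J̄) = closure V(J_V), X₁ = Bl_{J̄} X̃ is regular on the generic
fibre hence (Reg open on excellent schemes, X₁ → P¹ proper) over a dense open V, bad points c₁..c_r
closed; each c_i lies in an affine line chart, apply VerticalResolution to X₁|_{V_i} → V_i ⊂ A¹ (V_i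
∋ c_i avoiding the other c_j) to get Bl_{I_i} cosupported in the fibre over c_i, extend I_i by O off
that closed fibre, blow up ∏ I_i (disjoint cosupports: the blow-ups glue), compose the three
blow-ups (StacksProjec -/
@[route_item "route-ResolutionOfSingularities-VerticalModels", crux]
def PencilReduction : Prop :=
  VerticalResolution → _root_.ResolutionOfSingularities

/-- item stmt-ResolutionOfSingularities-16200 · crux · rank 5 · open · by planner
why it might fail: typing only — the composition lemma for IsBlowup with control of the composite ideal's support, integrality of blow-ups and transport of the finite-type hypotheses to X' must match the tree's API exactly.
sources: StacksProject, Hartshorne1977, Liu2002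
[crux] VERTICAL SPLIT: TameArcRegularization → WildCoreResolution → VerticalResolution. Proof on
paper: given vertical data (X, f, q), TameArcRegularization yields a blow-up π : X' → X along I
cosupported in the fibre with X' regular at all tame-reachable points of (X', π ≫ f, q); X' is again
integral (blow-up of an integral scheme along an ideal whose support is not everything), π ≫ f is
separated of finite type (blow-ups of Noetherian schemes are proper), the fibre complement is still
inhabited (π is an isomorphism off the support) and X' is regular off the fibre; WildCoreResolution
applied to (X', π ≫ f, q) yields a second fibre-cosupported blow-up with regular total space; two
blow-ups of a Noetherian integral scheme along fibre-cosupported ideals compose to ONE blow-up along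
a fibre-cosupported ideal (StacksProject 080B; tree BlowupsComposition /
IsBlowup.exists_isBlowup_comp_supported). [deps: TameArcRegularization, WildCoreResolution]
[difficulty: M] -/
@[route_item "route-ResolutionOfSingularities-VerticalModels", crux]
def VerticalSplit : Prop :=
  TameArcRegularization → WildCoreResolution → VerticalResolution

-- earlier Assembly (stmt-ResolutionOfSingularities-16201, replaced 2026-08-16T18:14:03Z -> stmt-ResolutionOfSingularities-16285): retired by None — TameArcRegularization → WildCoreResolution → VerticalSplit → PencilReduction → _root_.ResolutionOfSingularities
/-- item stmt-ResolutionOfSingularities-16285 · assembly · rank 1 · open · by planner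
sources: CossartPiltant2019, EGAIV3
[assembly] The two ENGINE cruxes decide the summit: TameArcRegularization → WildCoreResolution →
ResolutionOfSingularities. Restated by route-repair 2026-08-16 (the original `TameArcRegularization
→ WildCoreResolution → VerticalSplit → PencilReduction → summit` was the type of `closes`, flagged
ground.trivial = the route's only ground blocker, and assembly items cannot be dropped). Provable in
one line ONCE VerticalSplit (#5) and PencilReduction (#4) are proved: `fun hT hW =>
PencilReduction_holds (VerticalSplit_holds hT hW)` (checked as an `example` in the planner's
Sketch2.lean); it is not a hypothesis of `closes` (which keeps hT hW hS hR) and carries no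
mathematics beyond #4 + #5 — provers should close #4/#5 first and then this. -/
@[route_item "route-ResolutionOfSingularities-VerticalModels"]
def Assembly : Prop :=
  TameArcRegularization → WildCoreResolution → _root_.ResolutionOfSingularities

/-! D-0027 §2.1 — DECIDING THEOREM (planner-authored via `route open/edit --closes-file`; by planner-plan-novel-ResolutionOfSingularities-Re-dc19aa3a-c-v 2026-08-16T18:04:29Z):
its hypotheses are this route's items and its conclusion the sub-problem Statement (glue_lint), and it elaborates with this file. -/

/-- D-0027 §2.1 deciding theorem of route VerticalModels: pure logic — `VerticalSplit` composes the two engine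
cruxes (tame arcs by Néron dilatations and μ_e-quotients, then the wild core) into the models statement
`VerticalResolution`, and `PencilReduction` (induction on dimension through generic fibres of pencils over `k(t)`,
spreading of the blow-up ideal, base-local gluing of fibre-cosupported blow-ups, reduced ⇒ integral) turns the models
statement into the summit `ResolutionOfSingularities` by name. -/
@[closes "route-ResolutionOfSingularities-VerticalModels"] theorem closes (hT : TameArcRegularization) (hW : WildCoreResolution) (hS : VerticalSplit)
    (hR : PencilReduction) : _root_.ResolutionOfSingularities :=
  hR (hS hT hW)

end Summit.ResolutionOfSingularities.ResolutionOfSingularities.Theses.VerticalModels
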